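import Mathlib
import Summits.BirchSwinnertonDyer.BirchSwinnertonDyer.Theorems.ResidualThetaTransportAtTwoLambdaLowerBoundOExact
import HarnessLib

/-!
# Sketch (stub-ideation k3·g12, `stub_cmLambdaLower`, technique = decomposition) — the INTERIOR of the
# v2b piece S2 `stub_plusColemanO`: TORS + INJ (U52 (b) proved) + LIN (the one arithmetic residue, typed) + PUSH

HONEST FRAMING. THEOREMS ONLY, pure commutative algebra (`sorry`-free, no `def` of an arithmetic object, no
named fact, no instance). Nothing here proves `stub_cmLambdaLower` = RSL_g (stmt-BirchSwinnertonDyer-22608),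
(R≥)ᵖ (stmt-BirchSwinnertonDyer-26074) or the skeleton's `_of`; the two stubs of the v2a skeleton of record
(`Cruxes/ResidualSignedLambdaLowerCMAtTwo/Lines/onepair.lean`) stay OPEN; BSD is NOT proved by any of this.

WHAT THIS FILE DECOMPOSES. In the landed entry `LambdaLowerBoundO.residualSignedLambdaLowerCMAtTwo_of_parts`
(p682462) the supply `hsup` must produce, from (nz⁺) `Module.Finite ℚ₂ (ℚ₂ ⊗ Q)` and (i_D)
`f·(d+e) ≤ λ(Q)` with `Q := Λⁿ ⧸ span_Λ (𝒸 '' Λ_𝒪·z)`, `Λ = ℤ₂⟦X⟧`, `𝒸 = colⁿ ∘ locd₂`, the one-pair datum whose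
2-ADIC SHARE (critic's piece S2 `stub_plusColemanO` of the v2b split, STUB-PLAN rev 15 §0) is:
FIN `Module.Finite ℚ₂ (ℚ₂ ⊗ (P ⧸ span_ℤ₂ (locd '' Z)))`, COUNT `f·(d+Σ+e) ≤ λ(P ⧸ span_ℤ₂ (locd '' Z))` for
`P = P₂ × P_{S₀}`, and the injectivity of `𝒸` on `Z = Λ_𝒪·z` that decouples the `S₀`-block. We cut S2 into

* **S2a TORS** (`isTorsion_of_finite_baseChange`, PROVED): a `Λ`-module `M` (Λ a domain over `A`, `K ⊗_A Λ`
  infinite-dimensional, `K` flat) with `Module.Finite K (K ⊗_A M)` is `Λ`-TORSION; at the pins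
  (`isTorsion_of_finite_baseChange_two`): (nz⁺) ⟹ `Q` is `ℤ₂⟦X⟧`-torsion (`not_finite_baseChange_powerSeries`).
* **S2b INJ = U52 (b)** (`injective_of_isTorsion_quotient_range`, PROVED): a `Λ`-linear `ψ : N → P` between modules
  of the same finite rank `n`, `N` without zero smul-divisors, with `P ⧸ range ψ` torsion, is INJECTIVE (rank–nullity
  over a domain: `rank (ker ψ) = 0`, and a rank-zero submodule of a torsion-free module is `0`).
  CONSEQUENCE (`eq_zero_of_apply_smul_zeta_eq_zero`): `𝒸 (a•z) = 0 → a = 0` for all `a ∈ Λ_𝒪` — i.e. BOTH named uses of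
  the orphan K0b (injectivity of `𝒸` on `Λ_𝒪·z` AND `z` non-torsion, critic rev 15 S63/T39) follow from (nz⁺) WITHOUT
  Kato 12.4 (2)'s rank-one statement, PROVIDED S2c holds.
* **S2c LIN** (the hypothesis `hsemi`, shape `SemilinearOnZeta`; NOT proved — it is the one ARITHMETIC residue of S2):
  `a ↦ 𝒸 (a•z)` is `Λ`-SEMILINEAR along a ring automorphism `φ` of `ℤ₂⟦X⟧`: `𝒸 (j s • x) = φ s • 𝒸 x` on `Λ_𝒪·z`,
  `j = PowerSeries.map (padicIntToCoeffIntegers _)`. EXPECTED `φ = id` (Λ-LINEAR): RSL_g's `γ` and the twist theorem's local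
  `gH` are BOTH normalised by `κ.IsTopGenerator` (`κ γ = 1 = κ (res gH)`), so `γ⁻¹·res gH ∈ ker κ ≤ κ.layerSubgroup m` acts
  trivially on every layer `H¹(U_m, T)` (`ConjugationDescent.conjMap_eq_self_of_mem_one`, `EulerSystem.conjMap_mul_apply_one`):
  `conj_γ = conj_{res gH}` there — no unit `u`, no `(1+X)^u`; `φ` is kept as a binder only for robustness. Moreover the
  single-step identity LIN-X `𝒸 (X•x) = X•𝒸 x` (all `x ∈ Λ_𝒪·z`) plus the `𝒪`-constant mixing through `crd` already give
  `hsemi` for ALL `s` (polynomials by induction; power series by `X`-adic truncation, comparing `coeff`s in `ℤ₂⟦X⟧ⁿ` —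
  no topology on `I.H` is needed since the VALUES are power series): §8 `apply_smul_eq_smul_of_X_of_C` (S2c′, PROVED),
  end-to-end §9 `eq_zero_of_apply_smul_zeta_eq_zero_two_of_X_of_C` (LIN-X + LIN-C₀ + coordinates + (nz⁺) ⟹ U52 (b), PROVED).
  What remains of S2 for the arithmetic lane is therefore ONLY the two single-step identities at the pins.
  Its `col`-half is LANDED (`SignedColemanImage.exists_colemanPlusHom_coeff_two_twist`: `col (z ∘ g⁻¹) = (1+X)·col z`);
  its `pair`-half is the conjugation-equivariance of the pinned ρ-layer Tate pairing
  `pair m (conj_δ y) (δ•Q) = pair m y Q` (the Γ-twin of K-c's cores-compatibility (P1), NOT in the tree) read through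
  `Kato2004.IwasawaH1DataCoeff.proj_T_smul` (`proj (X•x) = conj_γ (proj x) − proj x`). Given `hsemi` and ℤ₂⟦X⟧-coordinates
  of `Λ_𝒪 = 𝒪⟦X⟧` (`bvec`, `crd`: from the HOLD's additive basis `B` coefficientwise) the Λ-LINEAR PRESENTATION `present`
  of `𝒸 '' Λ_𝒪·z` by `Λⁿ` is constructed here (`range_present`), which is what S2b consumes.
* **S2d PUSH** (`finite_baseChange_prodQuot`, `finrank_baseChange_prodQuot_eq`, `finite_and_count_prodQuot`, PROVED;
  the exact-sequence pattern is k1·g8's H10 `finrank_baseChange_prod_quot_range_eq`, here at a SUB-lattice `L ≤ P₂ × P_S`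
  with `L ∩ (0 × P_S) = 0` and with FIN DERIVED, not assumed): `0 → P_S → (P₂ × P_S)/L → P₂/π₁L → 0`, so
  FIN(P/L) ⟸ FIN(P₂/π₁L) ∧ FIN(P_S) and `λ(P/L) = λ(P_S) + λ(P₂/π₁L)`; with `π₁L = span_Λ(𝒸''Z)|_ℤ₂` (`map_fst_span_eq`,
  from S2c's set equality) and `L ∩ (0 × P_S) = 0` (`snd_eq_zero_of_fst_eq_zero`, from S2b's injectivity) this turns
  (nz⁺), (i_D) and the `S₀`-count `f·Σ ≤ λ(P_S)` (S1⊕) into FIN and COUNT of the supply.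

References: [Washington1997] §13.2 (λ-invariants and `Λ`-ranks); [Kobayashi2003] Thm. 7.3, Thm. 6.2 (6.13), §8 (8.20)–(8.23) (signed Coleman maps);
[Kato2004] Thm. 12.4; [Lang1990] Ch. 5 §1 (p. 94: `Λ ≅ ℤ_p⟦X⟧` depends on the generator) and Ch. 6 §2 (p. 111: the Iwasawa
involution, `⟨σ^λ, α⟩ = ⟨σ, α^{λ*}⟩` — a Galois-cohomological pairing is Λ-sesquilinear along an AUTOMORPHISM of Λ).
-/

set_option autoImplicit false
-- the Cruxes namespace of this sub repeats the summit name by design (D-0017 nested layout)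
set_option linter.dupNamespace false

noncomputable section

open scoped TensorProduct

namespace Summit.BirchSwinnertonDyer.BirchSwinnertonDyer.Cruxes.ResidualThetaCountLowerPureAtTwo.StubIdeasK3G12

universe u u' v w

/-! ## §1 S2a TORS — finite `K ⊗_A ·` forces `Λ`-torsion -/

section Torsion

variable {A : Type*} [CommRing A] (K : Type*) [Field K] [Algebra A K] [Module.Flat A K]
  {Λ : Type*} [CommRing Λ] [IsDomain Λ] [Algebra A Λ]
  {M : Type*} [AddCommGroup M] [Module Λ M] [Module A M] [IsScalarTower A Λ M]

/-- **S2a (TORS).** If `K ⊗_A Λ` is NOT finite over `K` but `K ⊗_A M` is, then every element of the `Λ`-module `M`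
is killed by a non-zero element of `Λ` (else `a ↦ a•x : Λ ↪ M`, and `K ⊗_A ·` is exact). Converse companion of the
landed `CharIdealLambda.finite_baseChange_of_isTorsion`. [cite: Washington1997, §13.2] -/
theorem isTorsion_of_finite_baseChange (hΛ : ¬ Module.Finite K (K ⊗[A] Λ)) [Module.Finite K (K ⊗[A] M)] :
    Module.IsTorsion Λ M := by
  intro x
  by_contra hx
  simp only [not_exists] at hx
  apply hΛ
  have hμ : Function.Injective ((LinearMap.toSpanSingleton Λ M x).restrictScalars A) := by
    rw [← LinearMap.ker_eq_bot, eq_bot_iff]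
    intro a ha
    rw [LinearMap.mem_ker, LinearMap.coe_restrictScalars, LinearMap.toSpanSingleton_apply] at ha
    by_contra ha0
    exact hx ⟨a, mem_nonZeroDivisors_of_ne_zero ha0⟩ ha
  refine Module.Finite.of_injective (((LinearMap.toSpanSingleton Λ M x).restrictScalars A).baseChange K) ?_
  rw [LinearMap.baseChange_eq_ltensor]
  exact Module.Flat.lTensor_preserves_injective_linearMap _ hμ

omit [IsDomain Λ] [Algebra A Λ] in
/-- `K ⊗_A A⟦X⟧` is not finite over `K`: it contains `K ⊗_A A[X]`, free on the monomials. [folklore] -/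
theorem not_finite_baseChange_powerSeries : ¬ Module.Finite K (K ⊗[A] PowerSeries A) := by
  intro h
  let ι : Polynomial A →ₗ[A] PowerSeries A :=
    { toFun := fun p => (p : PowerSeries A)
      map_add' := fun p q => Polynomial.coe_add p q
      map_smul' := fun c p => by simp }
  have hι : Function.Injective ι := Polynomial.coe_injective A
  have : Module.Finite K (K ⊗[A] Polynomial A) := by
    refine Module.Finite.of_injective (ι.baseChange K) ?_
    rw [LinearMap.baseChange_eq_ltensor]
    exact Module.Flat.lTensor_preserves_injective_linearMap ι hι
  have hfin := Module.Finite.finite_basis (Algebra.TensorProduct.basis K (Polynomial.basisMonomials A))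
  exact @not_finite ℕ _ hfin

end Torsion

/-! ## §2 S2b INJ — U52 (b): equal finite rank + torsion cokernel ⟹ injective (rank–nullity over a domain) -/

section Injective

variable {Λ : Type u} [CommRing Λ] [IsDomain Λ]
  {N : Type v} [AddCommGroup N] [Module Λ N] {P : Type v} [AddCommGroup P] [Module Λ P]

/-- **S2b (INJ, = U52 (b) of STUB-PLAN rev 15 as a standalone algebra fact).** A `Λ`-linear map between modules of the
same finite rank `n` whose cokernel is torsion is injective, provided the source has no zero smul-divisors:
`rank (range ψ) = rank P = n` (torsion quotient), so `rank (ker ψ) = 0`, so `ker ψ` is torsion, so `ker ψ = 0`.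
No duality, no non-torsion hypothesis on a generator, no rank-ONE input. [cite: Washington1997, §13.2] -/
theorem injective_of_isTorsion_quotient_range
    (hN : ∀ (a : Λ) (x : N), a • x = 0 → a = 0 ∨ x = 0) (ψ : N →ₗ[Λ] P) (n : ℕ)
    (hrN : Module.rank Λ N = n) (hrP : Module.rank Λ P = n)
    (htors : Module.IsTorsion Λ (P ⧸ LinearMap.range ψ)) : Function.Injective ψ := by
  have h1 := LinearMap.rank_range_add_rank_ker ψ
  have h2 := Submodule.rank_quotient_add_rank (LinearMap.range ψ)
  rw [rank_eq_zero_iff_isTorsion.mpr htors, zero_add] at h2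
  rw [h2, hrP, hrN] at h1
  have hker : Module.rank Λ (LinearMap.ker ψ) = 0 := by
    have hle : Module.rank Λ (LinearMap.ker ψ) ≤ n := (Submodule.rank_le (LinearMap.ker ψ)).trans hrN.le
    obtain ⟨m, hm⟩ := Cardinal.lt_aleph0.mp (hle.trans_lt (Cardinal.natCast_lt_aleph0 (n := n)))
    rw [hm] at h1 ⊢
    have hnm : n + m = n := by exact_mod_cast h1
    have hm0 : m = 0 := by omega
    simp [hm0]
  rw [← LinearMap.ker_eq_bot, eq_bot_iff]
  intro x hx
  obtain ⟨a, ha⟩ := (rank_eq_zero_iff_isTorsion.mp hker) (x := ⟨x, hx⟩)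
  have ha' : ((a : Λ) • (⟨x, hx⟩ : LinearMap.ker ψ) : LinearMap.ker ψ) = 0 := ha
  have ha'' : (a : Λ) • x = 0 := by simpa using congrArg Subtype.val ha'
  rcases hN _ _ ha'' with h | h
  · exact absurd h (nonZeroDivisors.coe_ne_zero a)
  · simpa using h

omit [IsDomain Λ] in
/-- `Λⁿ` has no zero smul-divisors over a domain `Λ` (coordinatewise). [folklore] -/
theorem smul_eq_zero_pi [NoZeroDivisors Λ] {n : ℕ} (a : Λ) (x : Fin n → Λ) (h : a • x = 0) : a = 0 ∨ x = 0 := by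
  refine or_iff_not_imp_left.mpr fun ha => funext fun i => ?_
  have hi : a * x i = 0 := by
    have := congrFun h i
    simpa only [Pi.smul_apply, smul_eq_mul, Pi.zero_apply] using this
  exact (mul_eq_zero.mp hi).resolve_left ha

end Injective

/-! ## §3 S2c LIN — the typed arithmetic residue, and the Λ-linear presentation of `𝒸 '' Λ_𝒪·z` it yields -/

section Presentation

variable {Λ : Type u} [CommRing Λ] {ΛO : Type u'} [CommRing ΛO]
  {H : Type v} [AddCommGroup H] [Module ΛO H] {V : Type w} [AddCommGroup V] [Module Λ V]

/-- **S2c (LIN), abstract shape** — the ONE arithmetic sub-stub of S2: along the coefficient map `j : Λ → Λ_𝒪`,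
`x ↦ 𝒸 x` is `Λ`-semilinear on `Λ_𝒪·z` for some ring automorphism `φ` of `Λ` (`φ = id` at the pins: `γ` and the local
`gH` are both `κ`-normalised, `κ γ = 1 = κ (res gH)`, so they induce the same conjugation on every layer). At the pins: `Λ = ℤ₂⟦X⟧`, `Λ_𝒪 = 𝒪⟦X⟧`,
`j = PowerSeries.map (padicIntToCoeffIntegers _)`, `𝒸 = colⁿ ∘ locd₂`, `z` Kato's zeta element; the `X`-case is
`proj_T_smul` + conjugation-equivariance of the ρ-layer Tate pairing + `exists_colemanPlusHom_coeff_two_twist`.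
[cite: Lang1990, Ch. 6 §2 (p. 111)] [cite: Kobayashi2003, Thm. 6.2 (6.13) (p. 12), §8 (8.20)–(8.23)] -/
def SemilinearOnZeta (j : Λ →+* ΛO) (𝒸 : H →+ V) (z : H) : Prop :=
  ∃ φ : Λ ≃+* Λ, ∀ (s : Λ) (x : H), x ∈ Submodule.span ΛO ({z} : Set H) → 𝒸 (j s • x) = φ s • 𝒸 x

variable (j : Λ →+* ΛO) (𝒸 : H →+ V) (z : H) (φ : Λ ≃+* Λ)
  (hsemi : ∀ (s : Λ) (x : H), x ∈ Submodule.span ΛO ({z} : Set H) → 𝒸 (j s • x) = φ s • 𝒸 x)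
  {ι : Type*} [Fintype ι] (bvec : ι → ΛO) (crd : ΛO →+ (ι → Λ))
  (hsum : ∀ a : ΛO, ∑ i, j (crd a i) * bvec i = a)

/-- **The Λ-linear presentation** `ν ↦ 𝒸 ((∑ᵢ j(φ⁻¹ νᵢ)·bᵢ)•z)` of `a ↦ 𝒸 (a•z)` through `Λ`-coordinates `(bᵢ)` of `Λ_𝒪`,
untwisted by `φ⁻¹` so that it is `Λ`-LINEAR (not merely semilinear). [cite: Lang1990, Ch. 6 §2 (p. 111)] -/
def present : (ι → Λ) →ₗ[Λ] V where
  toFun ν := 𝒸 ((∑ i, j (φ.symm (ν i)) * bvec i) • z)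
  map_add' ν ν' := by
    have hs : (∑ i, j (φ.symm ((ν + ν') i)) * bvec i)
        = (∑ i, j (φ.symm (ν i)) * bvec i) + ∑ i, j (φ.symm (ν' i)) * bvec i := by
      rw [← Finset.sum_add_distrib]
      exact Finset.sum_congr rfl fun i _ => by rw [Pi.add_apply, map_add, map_add, add_mul]
    rw [hs, add_smul, map_add]
  map_smul' r ν := by
    have hs : (∑ i, j (φ.symm ((r • ν) i)) * bvec i)
        = j (φ.symm r) * ∑ i, j (φ.symm (ν i)) * bvec i := by
      rw [Finset.mul_sum]
      exact Finset.sum_congr rfl fun i _ => by rw [Pi.smul_apply, smul_eq_mul, map_mul, map_mul, mul_assoc]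
    rw [RingHom.id_apply, hs, mul_smul,
      hsemi _ _ (Submodule.smul_mem _ _ (Submodule.mem_span_singleton_self z)), RingEquiv.apply_symm_apply]

theorem present_apply (ν : ι → Λ) :
    present j 𝒸 z φ hsemi bvec ν = 𝒸 ((∑ i, j (φ.symm (ν i)) * bvec i) • z) := rfl

include hsum in
/-- On the (twisted) coordinates of `a`, the presentation returns `𝒸 (a•z)`. [folklore] -/
theorem present_coord (a : ΛO) : present j 𝒸 z φ hsemi bvec (fun i => φ (crd a i)) = 𝒸 (a • z) := by
  rw [present_apply]
  simp only [RingEquiv.symm_apply_apply]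
  rw [hsum a]

include hsum in
/-- **`range (present) = span_Λ (𝒸 '' Λ_𝒪·z)`** — the Λ-span in the definition of `Q` of (nz⁺) IS the range of a
Λ-linear map out of the free module `Λ^ι`. [folklore] -/
theorem range_present :
    LinearMap.range (present j 𝒸 z φ hsemi bvec) =
      Submodule.span Λ (𝒸 '' (Submodule.span ΛO ({z} : Set H) : Set H)) := by
  apply le_antisymm
  · rintro _ ⟨ν, rfl⟩
    exact Submodule.subset_span ⟨_, Submodule.smul_mem _ _ (Submodule.mem_span_singleton_self z), rfl⟩
  · rw [Submodule.span_le]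
    rintro _ ⟨x, hx, rfl⟩
    obtain ⟨a, rfl⟩ := Submodule.mem_span_singleton.mp hx
    exact ⟨fun i => φ (crd a i), present_coord j 𝒸 z φ hsemi bvec crd hsum a⟩

include hsum in
/-- The image SET `𝒸 '' Λ_𝒪·z` is already the carrier of the Λ-submodule `range (present)` (so its `ℤ₂`-span, its
`Λ`-span and itself coincide — the Λ-STABILITY the count at `2` needs). [folklore] -/
theorem image_eq_range_present :
    𝒸 '' (Submodule.span ΛO ({z} : Set H) : Set H) = (LinearMap.range (present j 𝒸 z φ hsemi bvec) : Set V) := by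
  apply Set.Subset.antisymm
  · rintro _ ⟨x, hx, rfl⟩
    obtain ⟨a, rfl⟩ := Submodule.mem_span_singleton.mp hx
    exact ⟨fun i => φ (crd a i), present_coord j 𝒸 z φ hsemi bvec crd hsum a⟩
  · rintro _ ⟨ν, rfl⟩
    exact ⟨_, Submodule.smul_mem _ _ (Submodule.mem_span_singleton_self z), rfl⟩

end Presentation

/-! ## §4 S2a + S2b + S2c ⟹ `𝒸 (a•z) = 0 → a = 0` (injectivity on `Λ_𝒪·z` AND `z` non-torsion, K0b-free) -/

section InjOnZeta

variable {A : Type*} [CommRing A] (K : Type*) [Field K] [Algebra A K] [Module.Flat A K]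
  {Λ : Type u} [CommRing Λ] [IsDomain Λ] [Algebra A Λ]
  {ΛO : Type u'} [CommRing ΛO] {H : Type v} [AddCommGroup H] [Module ΛO H] {n : ℕ}
  (j : Λ →+* ΛO) (𝒸 : H →+ (Fin n → Λ)) (z : H) (φ : Λ ≃+* Λ)
  (hsemi : ∀ (s : Λ) (x : H), x ∈ Submodule.span ΛO ({z} : Set H) → 𝒸 (j s • x) = φ s • 𝒸 x)
  (bvec : Fin n → ΛO) (crd : ΛO →+ (Fin n → Λ))
  (hsum : ∀ a : ΛO, ∑ i, j (crd a i) * bvec i = a)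

include hsemi hsum in
/-- **INJ on `Λ_𝒪·z` from (nz⁺) alone (given LIN).** If `K ⊗_A Λ` is infinite-dimensional and
`K ⊗_A (Λⁿ ⧸ span_Λ (𝒸 '' Λ_𝒪·z))` is finite-dimensional, then `𝒸 (a•z) = 0 → a = 0` for every `a ∈ Λ_𝒪` — in
particular `z` is non-torsion and `𝒸` is injective on `Λ_𝒪·z`. Here `Λ_𝒪` has `Λ`-coordinates `crd` with `n` basis
vectors `bvec` (at the pins: `n = f = [𝒪 : ℤ₂]`, from the HOLD's additive basis `B`). [cite: Washington1997, §13.2] -/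
theorem eq_zero_of_apply_smul_zeta_eq_zero (hΛ : ¬ Module.Finite K (K ⊗[A] Λ))
    [Module.Finite K (K ⊗[A] ((Fin n → Λ) ⧸
      Submodule.span Λ (𝒸 '' (Submodule.span ΛO ({z} : Set H) : Set H))))]
    (a : ΛO) (ha : 𝒸 (a • z) = 0) : a = 0 := by
  have htors : Module.IsTorsion Λ ((Fin n → Λ) ⧸ LinearMap.range (present j 𝒸 z φ hsemi bvec)) := by
    rw [range_present j 𝒸 z φ hsemi bvec crd hsum]
    exact isTorsion_of_finite_baseChange K hΛ
  have hinj : Function.Injective (present j 𝒸 z φ hsemi bvec) :=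
    injective_of_isTorsion_quotient_range (fun c x h => smul_eq_zero_pi c x h) _ n
      (rank_fin_fun n) (rank_fin_fun n) htors
  have h0 : present j 𝒸 z φ hsemi bvec (fun i => φ (crd a i)) = present j 𝒸 z φ hsemi bvec 0 := by
    rw [present_coord j 𝒸 z φ hsemi bvec crd hsum, map_zero, ha]
  have hν := hinj h0
  have hcrd : crd a = 0 := by
    funext i
    have := congrFun hν i
    simpa using this
  rw [← hsum a, hcrd]
  simp

include hsemi hsum in
/-- Corollary: `𝒸` is injective on `Λ_𝒪·z`. [cite: Washington1997, §13.2] -/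
theorem injOn_span_zeta (hΛ : ¬ Module.Finite K (K ⊗[A] Λ))
    [Module.Finite K (K ⊗[A] ((Fin n → Λ) ⧸
      Submodule.span Λ (𝒸 '' (Submodule.span ΛO ({z} : Set H) : Set H))))] :
    ∀ x ∈ Submodule.span ΛO ({z} : Set H), 𝒸 x = 0 → x = 0 := by
  intro x hx h
  obtain ⟨a, rfl⟩ := Submodule.mem_span_singleton.mp hx
  rw [eq_zero_of_apply_smul_zeta_eq_zero K j 𝒸 z φ hsemi bvec crd hsum hΛ a h, zero_smul]

include hsum in
/-- The same with LIN packaged as the Prop `SemilinearOnZeta j 𝒸 z` (S2c-T): (nz⁺) ∧ LIN ⟹ `𝒸 (a•z) = 0 → a = 0`.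
[cite: Washington1997, §13.2] -/
theorem eq_zero_of_apply_smul_zeta_eq_zero_of_semilinearOnZeta (hΛ : ¬ Module.Finite K (K ⊗[A] Λ))
    (hlin : SemilinearOnZeta j 𝒸 z)
    [Module.Finite K (K ⊗[A] ((Fin n → Λ) ⧸
      Submodule.span Λ (𝒸 '' (Submodule.span ΛO ({z} : Set H) : Set H))))]
    (a : ΛO) (ha : 𝒸 (a • z) = 0) : a = 0 := by
  obtain ⟨φ', hsemi'⟩ := hlin
  exact eq_zero_of_apply_smul_zeta_eq_zero K j 𝒸 z φ' hsemi' bvec crd hsum hΛ a ha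

end InjOnZeta

/-! ## §5 S2d PUSH — the product quotient at a sub-lattice `L ≤ P₂ × P_S` with `L ∩ (0 × P_S) = 0` -/

section ProductQuotient

variable {A : Type u} [CommRing A] (K : Type w) [Field K] [Algebra A K] [IsFractionRing A K]
  {P₂ : Type v} [AddCommGroup P₂] [Module A P₂] {PS : Type v} [AddCommGroup PS] [Module A PS]
  (L : Submodule A (P₂ × PS))

/-- `P_S → (P₂ × P_S)/L`, `s ↦ [(0, s)]`. [folklore] -/
def inS : PS →ₗ[A] ((P₂ × PS) ⧸ L) := L.mkQ ∘ₗ LinearMap.inr A P₂ PS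

theorem le_comap_fst : L ≤ (L.map (LinearMap.fst A P₂ PS)).comap (LinearMap.fst A P₂ PS) :=
  fun _ hl => Submodule.mem_comap.mpr (Submodule.mem_map_of_mem hl)

/-- `(P₂ × P_S)/L → P₂/π₁(L)`, first projection. [folklore] -/
def toFst : ((P₂ × PS) ⧸ L) →ₗ[A] (P₂ ⧸ L.map (LinearMap.fst A P₂ PS)) :=
  L.mapQ (L.map (LinearMap.fst A P₂ PS)) (LinearMap.fst A P₂ PS) (le_comap_fst L)

@[simp] theorem inS_apply (s : PS) : inS L s = Submodule.Quotient.mk ((0 : P₂), s) := rfl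

@[simp] theorem toFst_mk (t : P₂ × PS) :
    toFst L (Submodule.Quotient.mk t) = Submodule.Quotient.mk t.1 := rfl

theorem toFst_surjective : Function.Surjective (toFst L) := by
  intro q
  induction q using Submodule.Quotient.induction_on with
  | H y => exact ⟨Submodule.Quotient.mk (y, 0), rfl⟩

/-- Exactness of `P_S → (P₂ × P_S)/L → P₂/π₁L`. [folklore] -/
theorem exact_inS_toFst : Function.Exact (inS L) (toFst L) := by
  rw [LinearMap.exact_iff]
  apply le_antisymm
  · intro q hq
    induction q using Submodule.Quotient.induction_on with
    | H t =>
      rw [LinearMap.mem_ker, toFst_mk, Submodule.Quotient.mk_eq_zero] at hq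
      obtain ⟨l, hl, hlt⟩ := Submodule.mem_map.mp hq
      rw [LinearMap.fst_apply] at hlt
      refine ⟨t.2 - l.2, ?_⟩
      rw [inS_apply, Submodule.Quotient.eq]
      have h : ((0 : P₂), t.2 - l.2) - t = -l := by
        ext
        · simp [hlt]
        · simp
      rw [h]
      exact L.neg_mem hl
  · rintro _ ⟨s, rfl⟩
    rw [LinearMap.mem_ker, inS_apply, toFst_mk]
    exact (Submodule.Quotient.mk_eq_zero _).mpr (Submodule.zero_mem _)

/-- `inS` is injective when `L ∩ (0 × P_S) = 0`. [folklore] -/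
theorem inS_injective (hL : ∀ l ∈ L, l.1 = 0 → l.2 = 0) : Function.Injective (inS L) := by
  rw [← LinearMap.ker_eq_bot, eq_bot_iff]
  intro s hs
  rw [LinearMap.mem_ker, inS_apply, Submodule.Quotient.mk_eq_zero] at hs
  have := hL _ hs rfl
  simpa using this

/-- **FIN of the product quotient is DERIVED**: `K ⊗ ((P₂ × P_S)/L)` is finite over `K` as soon as `K ⊗ P_S` and
`K ⊗ (P₂/π₁L)` are (flat base change of `P_S → (P₂ × P_S)/L → P₂/π₁L → 0`). [cite: Washington1997, §13.2] -/
theorem finite_baseChange_prodQuot [Module.Finite K (K ⊗[A] PS)]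
    [Module.Finite K (K ⊗[A] (P₂ ⧸ L.map (LinearMap.fst A P₂ PS)))] :
    Module.Finite K (K ⊗[A] ((P₂ × PS) ⧸ L)) := by
  haveI : Module.Flat A K := IsLocalization.flat K (nonZeroDivisors A)
  refine Module.Finite.of_exact (f := (inS L).baseChange K) (g := (toFst L).baseChange K) ?_ ?_
  · rw [LinearMap.baseChange_eq_ltensor, LinearMap.baseChange_eq_ltensor]
    exact Module.Flat.lTensor_exact K (exact_inS_toFst L)
  · rw [LinearMap.baseChange_eq_ltensor]
    exact LinearMap.lTensor_surjective K (toFst_surjective L)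

/-- **COUNT of the product quotient**: `λ((P₂ × P_S)/L) = λ(P_S) + λ(P₂/π₁L)` when `L ∩ (0 × P_S) = 0`
(`0 → P_S → (P₂ × P_S)/L → P₂/π₁L → 0` and `LambdaLowerBoundO.finrank_baseChange_eq_of_exact_three`; the pattern of
k1·g8 H10 `finrank_baseChange_prod_quot_range_eq`, there at `L = range (𝒸, locS)`). [cite: Washington1997, §13.2] -/
theorem finrank_baseChange_prodQuot_eq (hL : ∀ l ∈ L, l.1 = 0 → l.2 = 0) [Module.Finite K (K ⊗[A] PS)]
    [Module.Finite K (K ⊗[A] (P₂ ⧸ L.map (LinearMap.fst A P₂ PS)))] :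
    Module.finrank K (K ⊗[A] ((P₂ × PS) ⧸ L)) =
      Module.finrank K (K ⊗[A] PS) + Module.finrank K (K ⊗[A] (P₂ ⧸ L.map (LinearMap.fst A P₂ PS))) := by
  haveI := finite_baseChange_prodQuot K L
  exact Theorems.LambdaLowerBoundO.finrank_baseChange_eq_of_exact_three K (inS L) (toFst L) (inS_injective L hL)
    (exact_inS_toFst L) (toFst_surjective L)

/-- **S2d (PUSH) in the supply's numbers.** With `π₁L = N|_A` for a `Λ`-submodule `N ≤ P₂` (at the pins `P₂ = Λⁿ`,
`N = span_Λ (𝒸 '' Λ_𝒪·z)`, so `P₂ ⧸ N = Q` of (nz⁺)/(i_D)) and `L ∩ (0 × P_S) = 0`: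
FIN `Module.Finite K (K ⊗ ((P₂ × P_S)/L))` and COUNT `f·(d+Σ+e) ≤ λ((P₂ × P_S)/L)` follow from (nz⁺) `Module.Finite K (K ⊗ Q)`,
(i_D) `f·(d+e) ≤ λ(Q)`, FIN(P_S) and the `S₀`-count `f·Σ ≤ λ(P_S)` (S1⊕). [cite: Washington1997, §13.2]
[cite: Kobayashi2003, Thm. 7.3] -/
theorem finite_and_count_prodQuot {Λ : Type u'} [Ring Λ] [Module Λ P₂] [SMul A Λ] [IsScalarTower A Λ P₂]
    (N : Submodule Λ P₂) (hfst : L.map (LinearMap.fst A P₂ PS) = N.restrictScalars A)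
    (hL : ∀ l ∈ L, l.1 = 0 → l.2 = 0)
    [Module.Finite K (K ⊗[A] (P₂ ⧸ N))] [Module.Finite K (K ⊗[A] PS)]
    {f d e σ : ℕ} (hQ : f * (d + e) ≤ Module.finrank K (K ⊗[A] (P₂ ⧸ N)))
    (hS : f * σ ≤ Module.finrank K (K ⊗[A] PS)) :
    Module.Finite K (K ⊗[A] ((P₂ × PS) ⧸ L)) ∧
      f * (d + σ + e) ≤ Module.finrank K (K ⊗[A] ((P₂ × PS) ⧸ L)) := by
  let e₁ : (P₂ ⧸ L.map (LinearMap.fst A P₂ PS)) ≃ₗ[A] (P₂ ⧸ N) :=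
    (Submodule.quotEquivOfEq _ _ hfst).trans (Submodule.Quotient.restrictScalarsEquiv A N)
  haveI : Module.Finite K (K ⊗[A] (P₂ ⧸ L.map (LinearMap.fst A P₂ PS))) :=
    Module.Finite.equiv (e₁.baseChange A K _ _).symm
  have hrk : Module.finrank K (K ⊗[A] (P₂ ⧸ L.map (LinearMap.fst A P₂ PS))) =
      Module.finrank K (K ⊗[A] (P₂ ⧸ N)) := (e₁.baseChange A K _ _).finrank_eq
  refine ⟨finite_baseChange_prodQuot K L, ?_⟩
  rw [finrank_baseChange_prodQuot_eq K L hL, hrk]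
  have : f * (d + σ + e) = f * σ + f * (d + e) := by ring
  omega

end ProductQuotient

/-! ## §6 The two hypotheses of S2d from S2c (set equality) and S2b (injectivity) -/

section Providers

/-- **(hfst) from LIN**: if the image SET `𝒸 '' Z` is the carrier of a `Λ`-submodule `N` (`image_eq_range_present`), then
the first projection of `span_A ((𝒸, locS) '' Z)` is `N|_A`. [folklore] -/
theorem map_fst_span_eq {A : Type*} [CommSemiring A] {Λ : Type*} [Semiring Λ]
    {V : Type*} [AddCommGroup V] [Module A V] [Module Λ V] [SMul A Λ] [IsScalarTower A Λ V]
    {PS : Type*} [AddCommGroup PS] [Module A PS] {H : Type*}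
    (c : H → V) (lS : H → PS) (Z : Set H) (N : Submodule Λ V) (hN : c '' Z = (N : Set V)) :
    (Submodule.span A ((fun x => (c x, lS x)) '' Z)).map (LinearMap.fst A V PS) = N.restrictScalars A := by
  rw [Submodule.map_span, Set.image_image]
  have himg : (fun x => (LinearMap.fst A V PS) (c x, lS x)) '' Z = c '' Z :=
    Set.image_congr fun x _ => by simp
  rw [himg, hN]
  exact Submodule.span_eq (N.restrictScalars A)

/-- Elements of `span_A (locd '' Z)` are values `locd x`, `x ∈ Z`, when `Z` is `A`-saturated through `locd` (at the pins:
`locd (padicIntToCoeffIntegers _ a • x) = a • locd x` and `Z = Λ_𝒪·z` an `𝒪`-submodule). [folklore] -/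
theorem exists_preimage_of_mem_span {A : Type*} [Semiring A] {W : Type*} [AddCommGroup W] [Module A W]
    {H : Type*} [AddCommGroup H] (locd : H →+ W) (Z : AddSubgroup H)
    (hZ : ∀ (a : A) (x : H), x ∈ Z → ∃ x' ∈ Z, locd x' = a • locd x)
    {l : W} (hl : l ∈ Submodule.span A (locd '' (Z : Set H))) : ∃ x ∈ Z, locd x = l := by
  induction hl using Submodule.span_induction with
  | mem w hw =>
    obtain ⟨x, hx, rfl⟩ := hw
    exact ⟨x, hx, rfl⟩
  | zero => exact ⟨0, Z.zero_mem, map_zero locd⟩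
  | add u w _ _ hu hw =>
    obtain ⟨x, hx, rfl⟩ := hu
    obtain ⟨y, hy, rfl⟩ := hw
    exact ⟨x + y, Z.add_mem hx hy, map_add locd x y⟩
  | smul a w _ hw =>
    obtain ⟨x, hx, rfl⟩ := hw
    exact hZ a x hx

/-- **(hL) from INJ**: `span_A (locd '' Z) ∩ (0 × P_S) = 0` once `𝒸 = π₁ ∘ locd` is injective on `Z` (`injOn_span_zeta`).
[folklore] -/
theorem snd_eq_zero_of_fst_eq_zero {A : Type*} [Semiring A] {V : Type*} [AddCommGroup V] [Module A V]
    {PS : Type*} [AddCommGroup PS] [Module A PS] {H : Type*} [AddCommGroup H]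
    (locd : H →+ V × PS) (Z : AddSubgroup H)
    (hZ : ∀ (a : A) (x : H), x ∈ Z → ∃ x' ∈ Z, locd x' = a • locd x)
    (hinjZ : ∀ x ∈ Z, (locd x).1 = 0 → x = 0) :
    ∀ l ∈ Submodule.span A (locd '' (Z : Set H)), l.1 = 0 → l.2 = 0 := by
  intro l hl h1
  obtain ⟨x, hx, rfl⟩ := exists_preimage_of_mem_span locd Z hZ hl
  have hx0 := hinjZ x hx h1
  subst hx0
  rw [map_zero]
  rfl

end Providers

/-! ## §7 At the pins' currency: `A = ℤ₂`, `K = ℚ₂`, `Λ = ℤ₂⟦X⟧` -/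

section AtTwo

/-- **S2a at 2**: a `ℤ₂⟦X⟧`-module with `ℚ₂ ⊗_{ℤ₂} M` finite-dimensional is `ℤ₂⟦X⟧`-torsion; applied to
`M = Q = Λⁿ ⧸ span_Λ (𝒸 '' Λ_𝒪·z)` this is "(nz⁺) ⟹ `Q` torsion" of the critic's S63. [cite: Washington1997, §13.2] -/
theorem isTorsion_of_finite_baseChange_two {M : Type*} [AddCommGroup M] [Module (PowerSeries ℤ_[2]) M]
    [Module ℤ_[2] M] [IsScalarTower ℤ_[2] (PowerSeries ℤ_[2]) M]
    [Module.Finite ℚ_[2] (ℚ_[2] ⊗[ℤ_[2]] M)] : Module.IsTorsion (PowerSeries ℤ_[2]) M := by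
  haveI : Module.Flat ℤ_[2] ℚ_[2] := IsLocalization.flat ℚ_[2] (nonZeroDivisors ℤ_[2])
  exact isTorsion_of_finite_baseChange ℚ_[2] (not_finite_baseChange_powerSeries ℚ_[2])

/-- **INJ at 2 (the K0b-free replacement of the orphan hypothesis, given LIN)**: in the currency of (nz⁺) of
`residualSignedLambdaLowerCMAtTwo_of_parts` — `Λ = ℤ₂⟦X⟧`, `Q = (Fin n → Λ) ⧸ span_Λ (𝒸 '' ↑(span_{Λ_𝒪} {z}))` —
(nz⁺) and LIN give `𝒸 (a•z) = 0 → a = 0` on `Λ_𝒪`. [cite: Kato2004, Thm. 12.4] [cite: Washington1997, §13.2] -/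
theorem eq_zero_of_apply_smul_zeta_eq_zero_two {ΛO : Type u'} [CommRing ΛO] {H : Type v} [AddCommGroup H]
    [Module ΛO H] {n : ℕ} (j : PowerSeries ℤ_[2] →+* ΛO) (𝒸 : H →+ (Fin n → PowerSeries ℤ_[2])) (z : H)
    (φ : PowerSeries ℤ_[2] ≃+* PowerSeries ℤ_[2])
    (hsemi : ∀ (s : PowerSeries ℤ_[2]) (x : H), x ∈ Submodule.span ΛO ({z} : Set H) →
      𝒸 (j s • x) = φ s • 𝒸 x)
    (bvec : Fin n → ΛO) (crd : ΛO →+ (Fin n → PowerSeries ℤ_[2]))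
    (hsum : ∀ a : ΛO, ∑ i, j (crd a i) * bvec i = a)
    [Module.Finite ℚ_[2] (ℚ_[2] ⊗[ℤ_[2]] ((Fin n → PowerSeries ℤ_[2]) ⧸
      Submodule.span (PowerSeries ℤ_[2]) (𝒸 '' (Submodule.span ΛO ({z} : Set H) : Set H))))]
    (a : ΛO) (ha : 𝒸 (a • z) = 0) : a = 0 := by
  haveI : Module.Flat ℤ_[2] ℚ_[2] := IsLocalization.flat ℚ_[2] (nonZeroDivisors ℤ_[2])
  exact eq_zero_of_apply_smul_zeta_eq_zero ℚ_[2] j 𝒸 z φ hsemi bvec crd hsum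
    (not_finite_baseChange_powerSeries ℚ_[2]) a ha

end AtTwo

/-! ## §8 S2c′ — the finite-to-full reduction: LIN-X + LIN-C₀ already give `Λ`-linearity on `Λ_𝒪·z`

No topology on `I.H` is needed: the VALUES of `𝒸` are power series, and `Λⁿ = A⟦X⟧ⁿ` is `X`-adically separated
(coefficientwise). So the single-step identities `𝒸 (X•x) = X•𝒸 x` (LIN-X: `proj_T_smul` + conjugation-equivariance of
the pinned pairing + the landed Coleman twist) and `𝒸 (C a•x) = C a•𝒸 x` for constants `a ∈ A = ℤ₂` (LIN-C₀: the supply's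
own `ℤ₂`-semilinearity binder of `locd` + `col` linear) imply `hsemi` with `φ = id` for EVERY power series `s`. -/

section FiniteToFull

variable {A : Type*} [CommRing A] {ΛO : Type*} [CommRing ΛO] {H : Type*} [AddCommGroup H] [Module ΛO H]
  {V : Type*} [AddCommGroup V] [Module (PowerSeries A) V]

/-- `X`-ADIC SEPARATEDNESS of `A⟦X⟧ⁿ`: an `n`-tuple of power series divisible by every power of `X` is `0`
(compare coefficients). [folklore] -/
theorem eq_zero_of_forall_X_pow_smul {n : ℕ} (v : Fin n → PowerSeries A)
    (h : ∀ N : ℕ, ∃ w : Fin n → PowerSeries A, v = (PowerSeries.X : PowerSeries A) ^ N • w) : v = 0 := by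
  funext i
  ext m
  obtain ⟨w, hw⟩ := h (m + 1)
  have hvi : v i = (PowerSeries.X : PowerSeries A) ^ (m + 1) * w i := by
    rw [hw]; rfl
  rw [hvi, PowerSeries.coeff_X_pow_mul', if_neg (by omega)]
  simp

/-- LIN-X iterated: `𝒸 ((j X)^N • x) = X^N • 𝒸 x` on the submodule `S`. [folklore] -/
theorem apply_X_pow_smul (j : PowerSeries A →+* ΛO) (𝒸 : H →+ V) (S : Submodule ΛO H)
    (hX : ∀ x ∈ S, 𝒸 (j PowerSeries.X • x) = (PowerSeries.X : PowerSeries A) • 𝒸 x) (N : ℕ) :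
    ∀ x ∈ S, 𝒸 ((j PowerSeries.X) ^ N • x) = (PowerSeries.X : PowerSeries A) ^ N • 𝒸 x := by
  induction N with
  | zero => intro x _; simp
  | succ N ih =>
      intro x hx
      rw [pow_succ, mul_smul, ih _ (S.smul_mem _ hx), hX x hx, pow_succ, mul_smul]

/-- LIN-X + LIN-C₀ give the identity for every POLYNOMIAL `p ∈ A[X]`. [folklore] -/
theorem apply_coe_polynomial_smul (j : PowerSeries A →+* ΛO) (𝒸 : H →+ V) (S : Submodule ΛO H)
    (hX : ∀ x ∈ S, 𝒸 (j PowerSeries.X • x) = (PowerSeries.X : PowerSeries A) • 𝒸 x)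
    (hC : ∀ (a : A), ∀ x ∈ S, 𝒸 (j (PowerSeries.C a) • x) = (PowerSeries.C a : PowerSeries A) • 𝒸 x)
    (p : Polynomial A) : ∀ x ∈ S, 𝒸 (j (p : PowerSeries A) • x) = (p : PowerSeries A) • 𝒸 x := by
  induction p using Polynomial.induction_on' with
  | add p q hp hq =>
      intro x hx
      rw [Polynomial.coe_add, map_add, add_smul, map_add, hp x hx, hq x hx, add_smul]
  | monomial k a =>
      intro x hx
      rw [← Polynomial.C_mul_X_pow_eq_monomial, Polynomial.coe_mul, Polynomial.coe_pow, Polynomial.coe_C,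
        Polynomial.coe_X, map_mul, map_pow, mul_smul,
        hC a _ (S.smul_mem _ hx), apply_X_pow_smul j 𝒸 S hX k x hx, ← mul_smul]

/-- **S2c′ (finite-to-full, PROVED).** If `V` is `X`-adically separated, LIN-X and LIN-C₀ on a `Λ_𝒪`-submodule `S`
imply `𝒸 (j s • x) = s • 𝒸 x` for EVERY power series `s` and every `x ∈ S` — i.e. `hsemi` with `φ = id`.
Proof: `s = trunc_N s + X^N·t`, the polynomial case, LIN-X iterated; the defect is divisible by every `X^N`. [folklore] -/
theorem apply_smul_eq_smul_of_X_of_C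
    (hV : ∀ v : V, (∀ N : ℕ, ∃ w : V, v = (PowerSeries.X : PowerSeries A) ^ N • w) → v = 0)
    (j : PowerSeries A →+* ΛO) (𝒸 : H →+ V) (S : Submodule ΛO H)
    (hX : ∀ x ∈ S, 𝒸 (j PowerSeries.X • x) = (PowerSeries.X : PowerSeries A) • 𝒸 x)
    (hC : ∀ (a : A), ∀ x ∈ S, 𝒸 (j (PowerSeries.C a) • x) = (PowerSeries.C a : PowerSeries A) • 𝒸 x)
    (s : PowerSeries A) : ∀ x ∈ S, 𝒸 (j s • x) = s • 𝒸 x := by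
  intro x hx
  rw [← sub_eq_zero]
  apply hV
  intro N
  -- `s = trunc_N s + X^N * t`
  have hdvd : (PowerSeries.X : PowerSeries A) ^ N ∣ s - (PowerSeries.trunc N s : PowerSeries A) := by
    rw [PowerSeries.X_pow_dvd_iff]
    intro m hm
    rw [map_sub, Polynomial.coe_def] at *
    simp [PowerSeries.coeff_trunc, hm]
  obtain ⟨t, ht⟩ := hdvd
  have hs : s = (PowerSeries.trunc N s : PowerSeries A) + (PowerSeries.X : PowerSeries A) ^ N * t := by
    rw [← ht]; ring
  refine ⟨𝒸 (j t • x) - t • 𝒸 x, ?_⟩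
  conv_lhs => rw [hs]
  rw [map_add, add_smul, map_add, apply_coe_polynomial_smul j 𝒸 S hX hC _ x hx, map_mul, map_pow, mul_smul,
    apply_X_pow_smul j 𝒸 S hX N _ (S.smul_mem _ hx), add_smul, mul_smul, smul_sub]
  abel

/-- **S2c′ at the shape S2b consumes**: LIN-X + LIN-C₀ on `Λ_𝒪·z`, values in `A⟦X⟧ⁿ` ⟹ `SemilinearOnZeta j 𝒸 z`
(with `φ = RingEquiv.refl`). [folklore] -/
theorem semilinearOnZeta_of_X_of_C {n : ℕ} (j : PowerSeries A →+* ΛO) (𝒸 : H →+ (Fin n → PowerSeries A)) (z : H)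
    (hX : ∀ x ∈ Submodule.span ΛO ({z} : Set H),
      𝒸 (j PowerSeries.X • x) = (PowerSeries.X : PowerSeries A) • 𝒸 x)
    (hC : ∀ (a : A), ∀ x ∈ Submodule.span ΛO ({z} : Set H),
      𝒸 (j (PowerSeries.C a) • x) = (PowerSeries.C a : PowerSeries A) • 𝒸 x) :
    SemilinearOnZeta j 𝒸 z :=
  ⟨RingEquiv.refl _, fun s x hx =>
    apply_smul_eq_smul_of_X_of_C eq_zero_of_forall_X_pow_smul j 𝒸 _ hX hC s x hx⟩

end FiniteToFull

/-! ## §9 End-to-end at the pins' shape: LIN-X + LIN-C₀ + (nz⁺) ⟹ `𝒸 (a•z) = 0 → a = 0` (U52 (b), K0b-free) -/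

section EndToEnd

/-- **U52 (b) from (nz⁺) + the two single-step identities, at `Λ = ℤ₂⟦X⟧` (PROVED).** Inputs: LIN-X, LIN-C₀ on `Λ_𝒪·z`;
`ℤ₂⟦X⟧`-coordinates (`bvec`, `crd`, `hsum`) of `Λ_𝒪` along `j`; (nz⁺). Output: `a•z ∈ ker 𝒸 → a = 0` for all
`a ∈ Λ_𝒪` — hence `𝒸` is injective on `Λ_𝒪·z` AND `z` is non-torsion, with NO appeal to Kato 12.4 (2) (K0b).
[cite: Washington1997, §13.2] [cite: Kato2004, Thm. 12.4] -/
theorem eq_zero_of_apply_smul_zeta_eq_zero_two_of_X_of_C {ΛO : Type u'} [CommRing ΛO] {H : Type v} [AddCommGroup H]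
    [Module ΛO H] {n : ℕ} (j : PowerSeries ℤ_[2] →+* ΛO) (𝒸 : H →+ (Fin n → PowerSeries ℤ_[2])) (z : H)
    (hX : ∀ x ∈ Submodule.span ΛO ({z} : Set H),
      𝒸 (j PowerSeries.X • x) = (PowerSeries.X : PowerSeries ℤ_[2]) • 𝒸 x)
    (hC : ∀ (a : ℤ_[2]), ∀ x ∈ Submodule.span ΛO ({z} : Set H),
      𝒸 (j (PowerSeries.C a) • x) = (PowerSeries.C a : PowerSeries ℤ_[2]) • 𝒸 x)
    (bvec : Fin n → ΛO) (crd : ΛO →+ (Fin n → PowerSeries ℤ_[2])) (hsum : ∀ a : ΛO, ∑ i, j (crd a i) * bvec i = a)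
    [Module.Finite ℚ_[2] (ℚ_[2] ⊗[ℤ_[2]] ((Fin n → PowerSeries ℤ_[2]) ⧸
      Submodule.span (PowerSeries ℤ_[2]) (𝒸 '' (Submodule.span ΛO ({z} : Set H) : Set H))))]
    (a : ΛO) (ha : 𝒸 (a • z) = 0) : a = 0 :=
  eq_zero_of_apply_smul_zeta_eq_zero_two j 𝒸 z (RingEquiv.refl _)
    (fun s x hx => apply_smul_eq_smul_of_X_of_C eq_zero_of_forall_X_pow_smul j 𝒸 _ hX hC s x hx)
    bvec crd hsum a ha

end EndToEnd

end Summit.BirchSwinnertonDyer.BirchSwinnertonDyer.Cruxes.ResidualThetaCountLowerPureAtTwo.StubIdeasK3G12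

end
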